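import Summits.AtomisticToContinuum.HydrodynamicLimit.Theorems.CollisionIsometryCLTCollisionalTransferLocalityDefsB
import Summits.AtomisticToContinuum.HydrodynamicLimit.Theorems.CollisionIsometryCLTCollisionalTransferLocalityDefsC
import Literature.MathematicalPhysics.KineticTheory.EvenCollisionTubeFunctional
import HarnessLib

/-!
# [GKq] The mesoscale collisional energy-flux law from its cone-scale form and two-scale regularity
# (registered stub `stub_collisionalEnergyFluxLaw_of_cone`, line `hemisphere-affine-slaving`,
# crux `CollisionalTransferLocality`, stmt-AtomisticToContinuum-9518)

Supporting file (`--supports stmt-AtomisticToContinuum-9518`) proving the registered glue stub [GKq] VERBATIM: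
the cone-scale energy law [KqR] (hypothesis 1: uniformly in `τ ≤ t`, w.h.p.,
`|M_N^χ(τ) − (Rhs + Kfun)[b_r](0, χ)(τ)| ≤ η` for the FIXED cone kernel `b_r = fun _ y => coneKernel r y 0`,
`N → ∞` before `r → 0`) and the two-scale regularity of the energy value [TSχ] (hypothesis 2: w.h.p.
`|(Rhs + Kfun)[b_r](0, χ)(τ) − (Rhs + Kfun)[φ_N](0, χ)(τ)| ≤ η`, same quantifier shape) imply the mesoscale
energy law [Kq]: `sup_{τ ≤ t} |M_N^χ(τ) − (Rhs + Kfun)[φ_N](0, χ)(τ)| → 0` in local-Gibbs probability.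

Proof (pure measure plumbing). Thresholds `σ₀ := min σ₀^{KqR} σ₀^{TSχ}`, `η₁ := min η₁^{KqR} η₁^{TSχ}`
(the dilute event is monotone in the level: a lower ceiling is a smaller event, `measure_mono`). At
`(σ, Φ, t, kernel, χ, δ)` and a probability tolerance `e > 0`: radii `r₀^{KqR}(δ/2, e/2)`, `r₀^{TSχ}(δ/2, e/2)`,
`r := min r₀^{KqR} r₀^{TSχ} / 2`, particle numbers `N₀ := max N₀^{KqR} N₀^{TSχ}`; for `N ≥ N₀` the target event
`{∃ τ ≤ t, δ < |M − V_N|}` is covered (same `τ`, `abs_sub_le`) by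
`{∃ τ, δ/2 < |M − V_r|} ∪ {∃ τ, δ/2 < |V_r − V_N|}` (`GKq.measure_sup_le_of_halves`), of probability
`≤ e/2 + e/2 = e`; an `e`–`N₀` bound at every real level `e > 0` is `Tendsto … (𝓝 0)` in `ℝ≥0∞`
(`ENNReal.tendsto_atTop_zero`; the level `⊤` is trivial, a finite level `ε` is `ofReal ε.toReal`).
No new definitions; axioms `propext`, `Classical.choice`, `Quot.sound`.
-/

namespace Summit.AtomisticToContinuum.HydrodynamicLimit.Theorems.HemisphereAffineSlaving

open scoped BigOperators Topology Classical ENNReal InnerProductSpace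
open Filter Set Function MeasureTheory

noncomputable section

open Literature.MathematicalPhysics.KineticTheory (T3 V3)
open Literature.Analysis.FunctionSpaces

namespace GKq

/-! ## Plumbing -/

/-- The triangle-inequality union bound for a supremum event: if, outside events of probability `≤ e/2` each,
`|M − V| ≤ δ/2` and `|V − W| ≤ δ/2` uniformly on `S`, then `|M − W| ≤ δ` uniformly on `S` outside an event of
probability `≤ e`. [folklore] -/
theorem measure_sup_le_of_halves {α β : Type*} [MeasurableSpace α] (P : Measure α) (S : Set β) (δ e : ℝ)
    (he : 0 ≤ e) (M V W : α → β → ℝ)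
    (h1 : P {z | ∃ τ ∈ S, δ / 2 < |M z τ - V z τ|} ≤ ENNReal.ofReal (e / 2))
    (h2 : P {z | ∃ τ ∈ S, δ / 2 < |V z τ - W z τ|} ≤ ENNReal.ofReal (e / 2)) :
    P {z | ∃ τ ∈ S, δ < |M z τ - W z τ|} ≤ ENNReal.ofReal e := by
  calc P {z | ∃ τ ∈ S, δ < |M z τ - W z τ|}
      ≤ P ({z | ∃ τ ∈ S, δ / 2 < |M z τ - V z τ|} ∪ {z | ∃ τ ∈ S, δ / 2 < |V z τ - W z τ|}) := by
        refine measure_mono ?_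
        rintro z ⟨τ, hτ, hz⟩
        by_contra h
        simp only [mem_union, mem_setOf_eq, not_or, not_exists, not_and, not_lt] at h
        linarith [h.1 τ hτ, h.2 τ hτ, abs_sub_le (M z τ) (V z τ) (W z τ)]
    _ ≤ P {z | ∃ τ ∈ S, δ / 2 < |M z τ - V z τ|} + P {z | ∃ τ ∈ S, δ / 2 < |V z τ - W z τ|} :=
        measure_union_le _ _
    _ ≤ ENNReal.ofReal (e / 2) + ENNReal.ofReal (e / 2) := add_le_add h1 h2
    _ = ENNReal.ofReal e := by
        rw [← ENNReal.ofReal_add (by positivity) (by positivity), add_halves]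

end GKq

/-! ## The registered stub [GKq] -/

/-- [GKq] `stub_collisionalEnergyFluxLaw_of_cone` (registered glue stub of the line `hemisphere-affine-slaving`, skeleton v20,
VERBATIM): the cone-scale collisional energy-flux law [KqR] (hypothesis 1) and the two-scale regularity of the energy value
[TSχ] (hypothesis 2) imply the mesoscale collisional energy-flux law [Kq]. Thresholds `σ₀ := min σ₀^{KqR} σ₀^{TSχ}`,
`η₁ := min η₁^{KqR} η₁^{TSχ}`; at tolerance `δ` and probability `e`: both hypotheses at `(δ/2, e/2)`, a common radius
`r := min r₀^{KqR} r₀^{TSχ} / 2`, `N₀ := max`, and the triangle inequality at the same `τ`. [folklore] -/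
theorem stub_collisionalEnergyFluxLaw_of_cone : (∀ (a₀ θ₀ : T3 → ℝ) (u₀ : T3 → V3), NiceProfiles a₀ θ₀ u₀ → ∃ σ₀ : ℝ, 0 < σ₀ ∧ ∃ η₁ : ℝ, 0 < η₁ ∧ ∀ σ : ℝ, 0 < σ → σ < σ₀ → ∀ (Φ : Flows σ) (t : ℝ), 0 < t → VirialBounded σ a₀ θ₀ u₀ Φ t → ∀ (γ C : ℝ) (φ : ℕ → T3 → ℝ), 0 < γ → γ ≤ 1 / 15 → AdmissibleKernel γ C φ → DiluteAt σ a₀ θ₀ u₀ Φ t φ η₁ → ∀ (χ : ℝ → T3 → ℝ), Literature.Analysis.FunctionSpaces.Torus.IsSmoothSpaceTimeOn (Icc 0 t) χ → ∀ η δ : ℝ, 0 < η → 0 < δ → ∃ r₀ : ℝ, 0 < r₀ ∧ ∀ r : ℝ, 0 < r → r < r₀ → ∃ N₀ : ℕ, ∀ N : ℕ, N₀ ≤ N → Literature.MathematicalPhysics.KineticTheory.localGibbsLaw σ a₀ u₀ θ₀ N (Φ N) {z | ∃ τ ∈ Icc 0 t, η < |Mfun σ Φ (fun (_ : ℝ)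 (_ : T3) => (0 : V3)) χ N z τ - (Rhs σ Φ (fun (_ : ℕ) (y : T3) => Literature.MathematicalPhysics.KineticTheory.coneKernel r y 0) (fun (_ : ℝ) (_ : T3) => (0 : V3)) χ N z τ + Kfun σ Φ (fun (_ : ℕ) (y : T3) => Literature.MathematicalPhysics.KineticTheory.coneKernel r y 0) (fun (_ : ℝ) (_ : T3) => (0 : V3)) χ N z τ)|} ≤ ENNReal.ofReal δ) → (∀ (a₀ θ₀ : T3 → ℝ) (u₀ : T3 → V3), NiceProfiles a₀ θ₀ u₀ → ∃ σ₀ : ℝ, 0 < σ₀ ∧ ∃ η₁ : ℝ, 0 < η₁ ∧ ∀ σ : ℝ, 0 < σ → σ < σ₀ → ∀ (Φ : Flows σ) (t : ℝ), 0 < t → ∀ (γ C : ℝ) (φ : ℕ → T3 → ℝ), 0 < γ → γ ≤ 1 / 15 → AdmissibleKernel γ C φ → DiluteAt σ a₀ θ₀ u₀ Φ t φ η₁ → ∀ (χ : ℝ → T3 → ℝ), Literature.Analysis.FunctionSpaces.Torus.IsSmoothSpaceTimeOn (Icc 0 t) χ → ∀ η δ : ℝ, 0 < η → 0 < δ → ∃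 r₀ : ℝ, 0 < r₀ ∧ ∀ r : ℝ, 0 < r → r < r₀ → ∃ N₀ : ℕ, ∀ N : ℕ, N₀ ≤ N → Literature.MathematicalPhysics.KineticTheory.localGibbsLaw σ a₀ u₀ θ₀ N (Φ N) {z | ∃ τ ∈ Icc 0 t, η < |(Rhs σ Φ (fun (_ : ℕ) (y : T3) => Literature.MathematicalPhysics.KineticTheory.coneKernel r y 0) (fun (_ : ℝ) (_ : T3) => (0 : V3)) χ N z τ + Kfun σ Φ (fun (_ : ℕ) (y : T3) => Literature.MathematicalPhysics.KineticTheory.coneKernel r y 0) (fun (_ : ℝ) (_ : T3) => (0 : V3)) χ N z τ) - (Rhs σ Φ φ (fun (_ : ℝ) (_ : T3) => (0 : V3)) χ N z τ + Kfun σ Φ φ (fun (_ : ℝ) (_ : T3) => (0 : V3)) χ N z τ)|} ≤ ENNReal.ofReal δ) → ∀ (a₀ θ₀ : T3 → ℝ) (u₀ : T3 → V3), NiceProfiles a₀ θ₀ u₀ → ∃ σ₀ : ℝ, 0 < σ₀ ∧ ∃ η₁ : ℝ, 0 < η₁ ∧ ∀ σ : ℝ, 0 < σ → σ < σ₀ →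 ∀ (Φ : Flows σ) (t : ℝ), 0 < t → VirialBounded σ a₀ θ₀ u₀ Φ t → ∀ (γ C : ℝ) (φ : ℕ → T3 → ℝ), 0 < γ → γ ≤ 1 / 15 → AdmissibleKernel γ C φ → DiluteAt σ a₀ θ₀ u₀ Φ t φ η₁ → ∀ (χ : ℝ → T3 → ℝ), Literature.Analysis.FunctionSpaces.Torus.IsSmoothSpaceTimeOn (Icc 0 t) χ → ∀ δ : ℝ, 0 < δ → Tendsto (fun N : ℕ => Literature.MathematicalPhysics.KineticTheory.localGibbsLaw σ a₀ u₀ θ₀ N (Φ N) {z | ∃ τ ∈ Icc 0 t, δ < |Mfun σ Φ (fun (_ : ℝ) (_ : T3) => (0 : V3)) χ N z τ - (Rhs σ Φ φ (fun (_ : ℝ) (_ : T3) => (0 : V3)) χ N z τ + Kfun σ Φ φ (fun (_ : ℝ) (_ : T3) => (0 : V3)) χ N z τ)|}) atTop (𝓝 0) := by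
  intro hR hT a₀ θ₀ u₀ hP
  obtain ⟨σR, hσR, ηR, hηR, HR⟩ := hR a₀ θ₀ u₀ hP
  obtain ⟨σT, hσT, ηT, hηT, HT⟩ := hT a₀ θ₀ u₀ hP
  refine ⟨min σR σT, lt_min hσR hσT, min ηR ηT, lt_min hηR hηT, ?_⟩
  intro σ hσ hlt Φ t ht hV γ C φ hγ hγ' hadm hD χ hχ δ hδ
  -- the dilute event is monotone in the level (cf. `DiluteAt.mono`, …ChannelSplit, not importable here)
  have hmono : ∀ η' : ℝ, min ηR ηT ≤ η' → DiluteAt σ a₀ θ₀ u₀ Φ t φ η' := by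
    intro η' hle
    refine tendsto_of_tendsto_of_tendsto_of_le_of_le tendsto_const_nhds hD (fun _ => bot_le)
      (fun N => measure_mono ?_)
    rintro z ⟨s, hs, x, hx⟩
    exact ⟨s, hs, x, hle.trans_lt hx⟩
  -- the two hypotheses at this `(σ, Φ, t, kernel, χ)`
  have HR' := HR σ hσ (hlt.trans_le (min_le_left _ _)) Φ t ht hV γ C φ hγ hγ' hadm
    (hmono ηR (min_le_left _ _)) χ hχ
  have HT' := HT σ hσ (hlt.trans_le (min_le_right _ _)) Φ t ht γ C φ hγ hγ' hadm
    (hmono ηT (min_le_right _ _)) χ hχ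
  -- an `e`–`N₀` bound at every real level `e > 0` suffices (cf. `DockA.tendsto_zero_of_le_ofReal`)
  refine ENNReal.tendsto_atTop_zero.2 fun ε hε => ?_
  rcases eq_or_ne ε ⊤ with rfl | hne
  · exact ⟨0, fun _ _ => le_top⟩
  have he : 0 < ε.toReal := ENNReal.toReal_pos hε.ne' hne
  -- radii at tolerance `δ/2`, probability `e/2`; a common radius below both; particle numbers
  obtain ⟨rR, hrR, HrR⟩ := HR' (δ / 2) (ε.toReal / 2) (half_pos hδ) (half_pos he)
  obtain ⟨rT, hrT, HrT⟩ := HT' (δ / 2) (ε.toReal / 2) (half_pos hδ) (half_pos he)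
  have hmin : 0 < min rR rT := lt_min hrR hrT
  obtain ⟨NR, HNR⟩ := HrR (min rR rT / 2) (half_pos hmin) ((half_lt_self hmin).trans_le (min_le_left _ _))
  obtain ⟨NT, HNT⟩ := HrT (min rR rT / 2) (half_pos hmin) ((half_lt_self hmin).trans_le (min_le_right _ _))
  -- the triangle inequality at the same `τ`
  refine ⟨max NR NT, fun N hN => le_trans ?_ (ENNReal.ofReal_toReal hne).le⟩
  exact GKq.measure_sup_le_of_halves (Literature.MathematicalPhysics.KineticTheory.localGibbsLaw σ a₀ u₀ θ₀ N (Φ N))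
    (Icc 0 t) δ ε.toReal he.le _ _ _ (HNR N ((le_max_left _ _).trans hN)) (HNT N ((le_max_right _ _).trans hN))

end

end Summit.AtomisticToContinuum.HydrodynamicLimit.Theorems.HemisphereAffineSlaving
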